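import Literature.Analysis.Complex.UnitDiscHyperbolicAut
import Mathlib.Analysis.Convex.Topology
import Mathlib.Analysis.Complex.Convex
import HarnessLib

/-!
# Isometries of the hyperbolic disc are Möbius or anti-Möbius maps

Topic `Literature/Analysis/Complex`.  Beardon, *The Geometry of Discrete Groups*, Thm. 7.4.1: every
isometry of the hyperbolic plane is a Möbius map or an anti-Möbius map.  In the transcendental-free
language of `UnitDiscHyperbolic.lean` (`discCosh = cosh ρ`):

* `Literature.Analysis.Complex.exists_eq_discRot_or_conj_of_discCosh_eq` — a map `h : ℂ → ℂ`
  continuous on the unit ball, mapping it into itself and preserving `discCosh`, coincides on the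
  ball with `z ↦ c·φ_a(z)` or with `z ↦ c·φ_a(z̄)` (`‖c‖ = 1`, `‖a‖ < 1`).

Route: after composing with `φ_{h 0}` and a rotation, `h` fixes `0` and `1/2`; a point with
prescribed distances to `0` and `1/2` is determined up to complex conjugation (two-circle lemma), so
`h z ∈ {z, z̄}` pointwise; continuity on the two (connected) open half-discs and injectivity then
force `h = id` or `h = conj`.  This serves the closedness clause of [AbsTopIII] Prop. 2.2 (ii).

## Mathlib / tree

USED: `UnitDiscAutomorphisms`, `UnitDiscHyperbolic`, `UnitDiscHyperbolicAut`.
Proof-only file.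
-/

noncomputable section

open Set Filter Metric Function
open _root_.Complex
open scoped ComplexConjugate Topology

namespace Literature.Analysis.Complex

/-! ### The two-circle lemma -/

/-- Two points of `ℂ` with the same distance to `0` and the same distance to `1/2` are equal or
complex conjugate. [cite: Beardon1983, Thm. 7.4.1] -/
theorem eq_or_eq_conj_of_norm_eq {ζ z : ℂ} (h0 : ‖ζ‖ = ‖z‖) (h1 : ‖ζ - 1 / 2‖ = ‖z - 1 / 2‖) :
    ζ = z ∨ ζ = conj z := by
  have e0 : ζ.re * ζ.re + ζ.im * ζ.im = z.re * z.re + z.im * z.im := by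
    rw [← Complex.normSq_apply, ← Complex.normSq_apply, ← Complex.sq_norm, ← Complex.sq_norm, h0]
  have e1 : (ζ.re - 1 / 2) * (ζ.re - 1 / 2) + ζ.im * ζ.im =
      (z.re - 1 / 2) * (z.re - 1 / 2) + z.im * z.im := by
    have := congrArg (fun t : ℝ => t ^ 2) h1
    simp only [Complex.sq_norm, Complex.normSq_apply] at this
    simpa [sub_re, sub_im] using this
  have hre : ζ.re = z.re := by nlinarith
  have him : ζ.im * ζ.im = z.im * z.im := by nlinarith
  have him' : ζ.im = z.im ∨ ζ.im = -z.im := by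
    have : (ζ.im - z.im) * (ζ.im + z.im) = 0 := by nlinarith
    rcases mul_eq_zero.1 this with h | h
    · exact Or.inl (by linarith)
    · exact Or.inr (by linarith)
  rcases him' with h | h
  · exact Or.inl (Complex.ext hre h)
  · exact Or.inr (Complex.ext (by simpa using hre) (by simpa using h))

/-- On the ball, a `discCosh`-preserving map fixing `0` preserves `‖·‖`, and if it also fixes `1/2`
it preserves the distance to `1/2`. [cite: Beardon1983, Thm. 7.4.1] -/
theorem norm_sub_half_eq_of_discCosh_eq {h : ℂ → ℂ} (hm : MapsTo h (ball 0 1) (ball 0 1))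
    (hiso : ∀ z ∈ ball (0 : ℂ) 1, ∀ w ∈ ball (0 : ℂ) 1, discCosh (h z) (h w) = discCosh z w)
    (h0 : h 0 = 0) (hhalf : h (1 / 2) = 1 / 2) {z : ℂ} (hz : z ∈ ball (0 : ℂ) 1) :
    ‖h z‖ = ‖z‖ ∧ ‖h z - 1 / 2‖ = ‖z - 1 / 2‖ := by
  have hzn : ‖z‖ < 1 := mem_ball_zero_iff.1 hz
  have hhz : ‖h z‖ < 1 := mem_ball_zero_iff.1 (hm hz)
  have hhalfm : (1 / 2 : ℂ) ∈ ball (0 : ℂ) 1 := by rw [mem_ball_zero_iff]; norm_num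
  have hnorm : ‖h z‖ = ‖z‖ := by
    have e := hiso 0 (mem_ball_self one_pos) z hz
    rw [h0] at e
    exact norm_eq_norm_of_discCosh_zero_eq hhz hzn e
  refine ⟨hnorm, ?_⟩
  have e := hiso z hz (1 / 2) hhalfm
  rw [hhalf, discCosh, discCosh, hnorm] at e
  have h1 : 0 < 1 - ‖z‖ ^ 2 := by nlinarith [norm_nonneg z]
  have h2 : 0 < 1 - ‖(1 / 2 : ℂ)‖ ^ 2 := by norm_num
  have hD : (1 - ‖z‖ ^ 2) * (1 - ‖(1 / 2 : ℂ)‖ ^ 2) ≠ 0 := (mul_pos h1 h2).ne'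
  rw [add_right_inj, div_left_inj' hD, mul_right_inj' two_ne_zero] at e
  have := (sq_eq_sq₀ (norm_nonneg _) (norm_nonneg _)).1 e
  exact this

/-! ### Isometries fixing `0` and `1/2` -/

/-- An isometry of the hyperbolic disc (continuous, `discCosh`-preserving self-map of the ball) fixing
`0` and `1/2` is the identity or complex conjugation on the ball. [cite: Beardon1983, Thm. 7.4.1] -/
theorem eqOn_id_or_conj_of_discCosh_eq {h : ℂ → ℂ} (hc : ContinuousOn h (ball 0 1))
    (hm : MapsTo h (ball 0 1) (ball 0 1))
    (hiso : ∀ z ∈ ball (0 : ℂ) 1, ∀ w ∈ ball (0 : ℂ) 1, discCosh (h z) (h w) = discCosh z w)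
    (h0 : h 0 = 0) (hhalf : h (1 / 2) = 1 / 2) :
    EqOn h id (ball 0 1) ∨ EqOn h (fun z => conj z) (ball 0 1) := by
  -- pointwise: `h z = z` or `h z = conj z`
  have hpt : ∀ z ∈ ball (0 : ℂ) 1, h z = z ∨ h z = conj z := fun z hz =>
    let ⟨a, b⟩ := norm_sub_half_eq_of_discCosh_eq hm hiso h0 hhalf hz
    eq_or_eq_conj_of_norm_eq a b
  -- injectivity on the ball
  have hinj : InjOn h (ball 0 1) := by
    intro z hz w hw hzw
    have e := hiso z hz w hw
    rw [hzw, discCosh_self] at e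
    exact (discCosh_eq_one_iff (mem_ball_zero_iff.1 hz) (mem_ball_zero_iff.1 hw)).1 e.symm
  -- the two open half-discs
  set Dp : Set ℂ := ball 0 1 ∩ {z | 0 < z.im} with hDp
  set Dm : Set ℂ := ball 0 1 ∩ {z | z.im < 0} with hDm
  have hDpo : IsOpen Dp := isOpen_ball.inter (isOpen_lt continuous_const Complex.continuous_im)
  have hDmo : IsOpen Dm := isOpen_ball.inter (isOpen_lt Complex.continuous_im continuous_const)
  have hDpc : IsPreconnected Dp :=
    ((convex_ball (0 : ℂ) 1).inter (convex_halfSpace_im_gt (0 : ℝ))).isPreconnected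
  have hDmc : IsPreconnected Dm :=
    ((convex_ball (0 : ℂ) 1).inter (convex_halfSpace_im_lt (0 : ℝ))).isPreconnected
  -- the sets where `h = id`, resp. `h = conj`, are relatively closed, hence (by the dichotomy)
  -- relatively open in the ball
  set S : Set ℂ := {z | h z = z} with hS
  set T : Set ℂ := {z | h z = conj z} with hT
  -- open neighbourhoods inside the ball realising `S` and `T` off the real axis
  have key : ∀ (D : Set ℂ), IsOpen D → IsPreconnected D → D ⊆ ball 0 1 → (∀ z ∈ D, z.im ≠ 0) →
      (∀ z ∈ D, h z = z) ∨ (∀ z ∈ D, h z = conj z) := by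
    intro D hDo hDc hDb hDim
    -- `U := D ∩ h⁻¹(upper/lower)`-type description: on `D`, `h z = z ↔ (h z).im = z.im`
    have hSo : IsOpen (D ∩ {z | (h z - conj z) ≠ 0}) := by
      have : ContinuousOn (fun z => h z - conj z) D :=
        (hc.mono hDb).sub (Complex.continuous_conj.continuousOn)
      exact this.isOpen_inter_preimage hDo isOpen_ne
    have hTo : IsOpen (D ∩ {z | (h z - z) ≠ 0}) := by
      have : ContinuousOn (fun z => h z - z) D := (hc.mono hDb).sub continuousOn_id
      exact this.isOpen_inter_preimage hDo isOpen_ne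
    have hne : ∀ z ∈ D, z ≠ conj z := by
      intro z hz hzc
      apply hDim z hz
      have := congrArg Complex.im hzc
      simp at this
      linarith
    -- on `D`: `h z = z ↔ h z - conj z ≠ 0`, `h z = conj z ↔ h z - z ≠ 0`
    have hSe : D ∩ {z | h z - conj z ≠ 0} = D ∩ S := by
      ext z
      constructor
      · rintro ⟨hz, hz'⟩
        refine ⟨hz, ?_⟩
        rcases hpt z (hDb hz) with h' | h'
        · exact h'
        · exact absurd (by rw [h', sub_self]) hz'
      · rintro ⟨hz, hz'⟩
        refine ⟨hz, ?_⟩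
        show h z - conj z ≠ 0
        rw [show h z = z from hz', sub_ne_zero]
        exact hne z hz
    have hTe : D ∩ {z | h z - z ≠ 0} = D ∩ T := by
      ext z
      constructor
      · rintro ⟨hz, hz'⟩
        refine ⟨hz, ?_⟩
        rcases hpt z (hDb hz) with h' | h'
        · exact absurd (by rw [h', sub_self]) hz'
        · exact h'
      · rintro ⟨hz, hz'⟩
        refine ⟨hz, ?_⟩
        show h z - z ≠ 0
        rw [show h z = conj z from hz', sub_ne_zero]
        exact (hne z hz).symm
    rw [hSe] at hSo
    rw [hTe] at hTo
    have hcover : D ⊆ (D ∩ S) ∪ (D ∩ T) := fun z hz =>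
      (hpt z (hDb hz)).elim (fun h' => Or.inl ⟨hz, h'⟩) fun h' => Or.inr ⟨hz, h'⟩
    have hdisj : Disjoint (D ∩ S) (D ∩ T) := by
      rw [Set.disjoint_left]
      rintro z ⟨hz, hzS⟩ ⟨-, hzT⟩
      exact hne z hz (hzS.symm.trans hzT)
    rcases hDc.subset_or_subset hSo hTo hdisj hcover with hsub | hsub
    · exact Or.inl fun z hz => (hsub hz).2
    · exact Or.inr fun z hz => (hsub hz).2
  have hDpb : Dp ⊆ ball 0 1 := inter_subset_left
  have hDmb : Dm ⊆ ball 0 1 := inter_subset_left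
  have kp := key Dp hDpo hDpc hDpb fun z hz => hz.2.ne'
  have km := key Dm hDmo hDmc hDmb fun z hz => hz.2.ne
  -- test points `± i/2`
  have hip : (Complex.I / 2 : ℂ) ∈ Dp := by
    refine ⟨by rw [mem_ball_zero_iff]; simp; norm_num, ?_⟩
    show 0 < (Complex.I / 2 : ℂ).im
    simp
  have him : (-(Complex.I / 2) : ℂ) ∈ Dm := by
    refine ⟨by rw [mem_ball_zero_iff]; simp; norm_num, ?_⟩
    show (-(Complex.I / 2) : ℂ).im < 0
    simp
  have hconjI : conj (Complex.I / 2) = -(Complex.I / 2) := by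
    rw [map_div₀, Complex.conj_I, map_ofNat]; ring
  -- real points: `h z = z`
  have hreal : ∀ z ∈ ball (0 : ℂ) 1, z.im = 0 → h z = z := by
    intro z hz hzi
    rcases hpt z hz with h' | h'
    · exact h'
    · rw [h']; exact Complex.ext (by simp) (by simp [hzi])
  rcases kp with kp | kp <;> rcases km with km | km
  · -- id on both halves
    left
    intro z hz
    rcases lt_trichotomy z.im 0 with hlt | heq | hgt
    · exact km z ⟨hz, hlt⟩
    · exact hreal z hz heq
    · exact kp z ⟨hz, hgt⟩
  · -- id above, conj below: not injective
    exfalso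
    have e1 := kp _ hip
    have e2 := km _ him
    rw [map_neg, hconjI, neg_neg] at e2
    have := hinj (hDpb hip) (hDmb him) (e1.trans e2.symm)
    have := congrArg Complex.im this
    simp at this
    norm_num at this
  · -- conj above, id below: not injective
    exfalso
    have e1 := kp _ hip
    have e2 := km _ him
    rw [hconjI] at e1
    have := hinj (hDpb hip) (hDmb him) (e1.trans e2.symm)
    have := congrArg Complex.im this
    simp at this
    norm_num at this
  · -- conj on both halves
    right
    intro z hz
    rcases lt_trichotomy z.im 0 with hlt | heq | hgt
    · exact km z ⟨hz, hlt⟩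
    · rw [hreal z hz heq]; exact Complex.ext (by simp) (by simp [heq])
    · exact kp z ⟨hz, hgt⟩

/-- `φ_{-b} (c z) = c · φ_{-b c̄} (z)` for `‖c‖ = 1` (local copy of the identity of
`UnitDiscRCAutomorphisms`, keeping this file independent of the normaliser files). [folklore] -/
private theorem discMobius_neg_mul_aux {c : ℂ} (hc : ‖c‖ = 1) (b z : ℂ) :
    discMobius (-b) (c * z) = discRot c (-(b * conj c)) z := by
  have hcc : c * conj c = 1 := by
    rw [mul_conj', ← ofReal_pow, hc]; norm_num
  have hnum : c * (z + b * conj c) = c * z + b := by linear_combination b * hcc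
  rw [discRot, discMobius_apply, discMobius_apply]
  simp only [map_neg, map_mul, conj_conj, neg_mul, sub_neg_eq_add]
  rw [mul_div_assoc', hnum]
  congr 1
  ring

/-! ### Beardon 7.4.1 -/

/-- **Isometries of the hyperbolic disc are Möbius or anti-Möbius** (Beardon Thm. 7.4.1): a map
`h : ℂ → ℂ`, continuous on the unit ball, mapping it into itself and preserving `discCosh = cosh ρ`,
coincides on the ball with `z ↦ c·φ_a(z)` or with `z ↦ c·φ_a(z̄)` for some `‖c‖ = 1`, `‖a‖ < 1`.
[cite: Beardon1983, Thm. 7.4.1] -/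
theorem exists_eq_discRot_or_conj_of_discCosh_eq {h : ℂ → ℂ} (hc : ContinuousOn h (ball 0 1))
    (hm : MapsTo h (ball 0 1) (ball 0 1))
    (hiso : ∀ z ∈ ball (0 : ℂ) 1, ∀ w ∈ ball (0 : ℂ) 1, discCosh (h z) (h w) = discCosh z w) :
    ∃ c a : ℂ, ‖c‖ = 1 ∧ ‖a‖ < 1 ∧
      (EqOn h (discRot c a) (ball 0 1) ∨ EqOn h (fun z => discRot c a (conj z)) (ball 0 1)) := by
  -- move `b = h 0` to `0`
  set b := h 0 with hb
  have hbn : ‖b‖ < 1 := mem_ball_zero_iff.1 (hm (mem_ball_self one_pos))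
  set h₁ : ℂ → ℂ := discMobius b ∘ h with hh₁
  have hφm := mapsTo_discMobius hbn
  have h₁c : ContinuousOn h₁ (ball 0 1) := (differentiableOn_discMobius hbn).continuousOn.comp hc hm
  have h₁m : MapsTo h₁ (ball 0 1) (ball 0 1) := hφm.comp hm
  have h₁iso : ∀ z ∈ ball (0 : ℂ) 1, ∀ w ∈ ball (0 : ℂ) 1, discCosh (h₁ z) (h₁ w) = discCosh z w := by
    intro z hz w hw
    simp only [hh₁, comp_apply]
    rw [discCosh_discMobius hbn (mem_ball_zero_iff.1 (hm hz)) (mem_ball_zero_iff.1 (hm hw))]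
    exact hiso z hz w hw
  have h₁0 : h₁ 0 = 0 := by simp [hh₁, hb]
  -- rotate so that `1/2` is fixed
  have hhalfm : (1 / 2 : ℂ) ∈ ball (0 : ℂ) 1 := by rw [mem_ball_zero_iff]; norm_num
  set u := h₁ (1 / 2) with hu
  have hun : ‖u‖ = 1 / 2 := by
    have e := h₁iso 0 (mem_ball_self one_pos) (1 / 2) hhalfm
    rw [h₁0] at e
    have := norm_eq_norm_of_discCosh_zero_eq (mem_ball_zero_iff.1 (h₁m hhalfm))
      (by norm_num : ‖(1 / 2 : ℂ)‖ < 1) e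
    rw [this]; norm_num
  set c : ℂ := 2 * u with hcdef
  have hcn : ‖c‖ = 1 := by rw [hcdef, norm_mul, hun]; norm_num
  have hc0 : c ≠ 0 := norm_ne_zero_iff.1 (by rw [hcn]; exact one_ne_zero)
  have hcn' : ‖c⁻¹‖ = 1 := by rw [norm_inv, hcn, inv_one]
  set h₂ : ℂ → ℂ := fun z => c⁻¹ * h₁ z with hh₂
  have h₂c : ContinuousOn h₂ (ball 0 1) := continuousOn_const.mul h₁c
  have h₂m : MapsTo h₂ (ball 0 1) (ball 0 1) := (mapsTo_mul_ball hcn').comp h₁m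
  have h₂iso : ∀ z ∈ ball (0 : ℂ) 1, ∀ w ∈ ball (0 : ℂ) 1, discCosh (h₂ z) (h₂ w) = discCosh z w := by
    intro z hz w hw
    simp only [hh₂]
    rw [discCosh_mul hcn', h₁iso z hz w hw]
  have h₂0 : h₂ 0 = 0 := by simp [hh₂, h₁0]
  have hu0 : u ≠ 0 := norm_ne_zero_iff.1 (by rw [hun]; norm_num)
  have h₂half : h₂ (1 / 2) = 1 / 2 := by
    simp only [hh₂, ← hu, hcdef]
    field_simp
  rcases eqOn_id_or_conj_of_discCosh_eq h₂c h₂m h₂iso h₂0 h₂half with hid | hconj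
  · -- `h = φ_{-b} ∘ (c ·)`
    refine ⟨c, -(b * conj c), hcn, by rw [norm_neg, norm_mul, norm_conj, hcn, mul_one]; exact hbn,
      Or.inl fun z hz => ?_⟩
    have e1 : h₁ z = c * z := by
      have := hid hz
      simp only [hh₂, id] at this
      calc h₁ z = c * (c⁻¹ * h₁ z) := by rw [← mul_assoc, mul_inv_cancel₀ hc0, one_mul]
        _ = c * z := by rw [this]
    have e2 : h z = discMobius (-b) (h₁ z) := by
      simp only [hh₁, comp_apply]
      rw [discMobius_neg_discMobius hbn (mem_ball_zero_iff.1 (hm hz)).le]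
    rw [e2, e1, discMobius_neg_mul_aux hcn]
  · refine ⟨c, -(b * conj c), hcn, by rw [norm_neg, norm_mul, norm_conj, hcn, mul_one]; exact hbn,
      Or.inr fun z hz => ?_⟩
    have e1 : h₁ z = c * conj z := by
      have := hconj hz
      simp only [hh₂] at this
      calc h₁ z = c * (c⁻¹ * h₁ z) := by rw [← mul_assoc, mul_inv_cancel₀ hc0, one_mul]
        _ = c * conj z := by rw [this]
    have e2 : h z = discMobius (-b) (h₁ z) := by
      simp only [hh₁, comp_apply]
      rw [discMobius_neg_discMobius hbn (mem_ball_zero_iff.1 (hm hz)).le]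
    rw [e2, e1, discMobius_neg_mul_aux hcn]

end Literature.Analysis.Complex
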